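import Literature.Topology.FourManifolds.RouteGraph
import HarnessLib

/-!
# The fingertip of the pushed attaching circle is a graph over the twisted height

Topic `Literature/Topology/FourManifolds`; fact seat `provefact-IsStrictHandleSlide.isSurgery`
(R. C. Kirby, *The Topology of 4-Manifolds*, LNM 1374 (1989), Ch. I §4, Fig. 4.2; remaining content:
the named fact (S) `Literature.Topology.FourManifolds.FramedLink.IsStrictHandleSlide.slideModel`).
Companion of `RouteMonotone.lean` for the other curve of the sweep: the fingertip of the finger knot
`K₁` (`K1Loop.lean`), read in the slice as a curve `h ↦ (r h, θ h)` over the height with `θ`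
strictly decreasing, radius non-increasing while `θ > 0` and non-decreasing while `θ < 0`
(non-decreasing towards both tips), and staying below the tip line (`r ≤ r_D`, `|θ| ≤ θ_D` with
`e^{c r_D} tan (θ_D/2) = 1`). Then its twisted height `y = r sin (twistAngle c r θ)` is strictly
decreasing in `h`:

* `curveY_deriv_neg_of_finger` — the pointwise criterion (`ṙ sin α ≤ 0`, `cos α > 0`, `θ̇ < 0`);
* `cos_twistAngle_pos_of_lt` — strictly below the tip line the twist angle is strictly within
  `(-π/2, π/2)`;
* `strictAntiOn_fingerY` — the monotonicity statement for a height-parametrised slice curve.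

## References

* R. C. Kirby, *The Topology of 4-Manifolds*, LNM 1374, Springer (1989), Ch. I §4. [Kirby1989]
-/

open scoped Topology
open Set Real Filter

noncomputable section

namespace Literature.Topology.FourManifolds

/-- **Pointwise criterion on the fingertip**: `ṙ sin α ≤ 0`, `cos α > 0`, `θ̇ < 0` (and `R, q > 0`,
`c ≥ 0`) give `ẏ < 0`. [folklore] -/
theorem curveY_deriv_neg_of_finger {c R r' θ' α q : ℝ} (hc : 0 ≤ c) (hR : 0 < R) (hq : 0 < q)
    (hθ : θ' < 0) (hcos : 0 < cos α) (hrs : r' * sin α ≤ 0) :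
    r' * sin α + R * (cos α * (c * sin α * r' + q * θ')) < 0 := by
  rw [curveY_deriv_eq]
  have h1 : r' * sin α * (1 + R * c * cos α) ≤ 0 :=
    mul_nonpos_of_nonpos_of_nonneg hrs (by positivity)
  have h2 : R * cos α * q * θ' < 0 := mul_neg_of_pos_of_neg (by positivity) hθ
  linarith

/-- **Strictly below the tip line the twist angle is strictly right of the vertical**: if
`e^{c r_T} tan (θ_T/2) = 1`, `c ≥ 0`, `r ≤ r_T`, `|θ| < θ_T < π`, then `cos (twistAngle c r θ) > 0`.
[folklore] -/
theorem cos_twistAngle_pos_of_lt {c r rT θ θT : ℝ} (hc : 0 ≤ c) (hr : r ≤ rT) (hθ : |θ| < θT)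
    (hθT : θT < π) (htip : exp (c * rT) * tan (θT / 2) = 1) : 0 < cos (twistAngle c r θ) := by
  -- reduce to `θ ≥ 0` by evenness
  wlog h0 : 0 ≤ θ generalizing θ
  · have h := this (θ := -θ) (by rwa [abs_neg]) (by linarith [lt_of_not_ge h0])
    rwa [twistAngle_neg, cos_neg] at h
  have hθ' : θ < θT := (le_abs_self θ).trans_lt hθ
  have hθT0 : 0 < θT := h0.trans_lt hθ'
  -- `tan (θ/2) < tan (θ_T/2)` and `e^{c r} ≤ e^{c r_T}`
  have ht : tan (θ / 2) < tan (θT / 2) :=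
    strictMonoOn_tan ⟨by linarith [pi_pos], by linarith⟩ ⟨by linarith [pi_pos], by linarith⟩ (by linarith)
  have ht0 : 0 ≤ tan (θ / 2) := tan_nonneg_of_nonneg_of_le_pi_div_two (by linarith) (by linarith)
  have he : exp (c * r) ≤ exp (c * rT) := exp_le_exp.2 (mul_le_mul_of_nonneg_left hr hc)
  have hprod : exp (c * r) * tan (θ / 2) < 1 := by
    calc exp (c * r) * tan (θ / 2) ≤ exp (c * rT) * tan (θ / 2) := mul_le_mul_of_nonneg_right he ht0
      _ < exp (c * rT) * tan (θT / 2) := mul_lt_mul_of_pos_left ht (exp_pos _)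
      _ = 1 := htip
  have hlt : twistAngle c r θ < π / 2 := by
    unfold twistAngle
    have := arctan_strictMono hprod
    rw [arctan_one] at this
    linarith
  have hge : 0 ≤ twistAngle c r θ := by
    rcases h0.eq_or_lt with h | h
    · rw [← h, twistAngle_zero]
    · exact (twistAngle_pos c r ⟨h, by linarith⟩).le
  exact cos_pos_of_mem_Ioo ⟨by linarith [pi_pos], hlt⟩

/-- **The fingertip is a graph over the twisted height.** Let `h ↦ (r h, θ h)` be a slice curve over
`[a, b]` with `θ̇ < 0`, `r > 0`, `θ ∈ (-π, π)`, and on the open interval `cos α > 0` and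
`ṙ sin α ≤ 0`. Then `y = r sin α` is strictly decreasing on `[a, b]`. [cite: Kirby1989, Ch. I §4] -/
theorem strictAntiOn_fingerY {c a b : ℝ} (hc : 0 ≤ c) {r θ dr dθ : ℝ → ℝ}
    (hr : ∀ h ∈ Icc a b, HasDerivAt r (dr h) h) (hθ : ∀ h ∈ Icc a b, HasDerivAt θ (dθ h) h)
    (hθm : ∀ h ∈ Icc a b, θ h ∈ Ioo (-π) π) (hrpos : ∀ h ∈ Icc a b, 0 < r h)
    (hdθ : ∀ h ∈ Ioo a b, dθ h < 0)
    (hcos : ∀ h ∈ Ioo a b, 0 < cos (twistAngle c (r h) (θ h)))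
    (hsign : ∀ h ∈ Ioo a b, dr h * sin (twistAngle c (r h) (θ h)) ≤ 0) :
    StrictAntiOn (fun h ↦ r h * sin (twistAngle c (r h) (θ h))) (Icc a b) := by
  have hd : ∀ h ∈ Icc a b, HasDerivAt (fun h ↦ r h * sin (twistAngle c (r h) (θ h)))
      (dr h * sin (twistAngle c (r h) (θ h)) +
        r h * (cos (twistAngle c (r h) (θ h)) * (c * sin (twistAngle c (r h) (θ h)) * dr h + twistQ c (r h) (θ h) * dθ h))) h :=
    fun h hh ↦ hasDerivAt_curveY c (hr h hh) (hθ h hh) (hθm h hh)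
  refine strictAntiOn_of_deriv_neg (convex_Icc _ _) (fun h hh ↦ (hd h hh).continuousAt.continuousWithinAt) ?_
  intro h hh
  rw [interior_Icc] at hh
  have hh' := Ioo_subset_Icc_self hh
  rw [(hd h hh').deriv]
  exact curveY_deriv_neg_of_finger hc (hrpos h hh') (twistQ_pos c (r h) (hθm h hh')) (hdθ h hh) (hcos h hh) (hsign h hh)

end Literature.Topology.FourManifolds
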